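import Summits.KontsevichZagierPeriods.KontsevichZagierPeriods.Theorems.LinRedNormalFormArrangementNormalFormSeparateTwoHIOrder
import Summits.KontsevichZagierPeriods.KontsevichZagierPeriods.Theorems.LinRedNormalFormArrangementNormalFormSeparateTwoHIAlgebra

/-!
# The Taylor pieces on one thin sector: the three ray theorems

(Line `janus-bands`, crux `ArrangementNormalForm`, stub `stub_separateTwoPos_hI`, part `HIRay`.)
The analytic core of the termwise convergence `hI` at a point `z₁` of the closed base piece, on a
thin sector adjacent to the ray of slope `s` (`|s| ≤ 2`, side `σ = ±1`, transversal variable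
`u = s + σ v`), in abstract form. The weight is `wt = ofReal (phi) · Λ'` with the scalar part
`phi t v = t / (t^D |u|^M ω(t, v))` (`t` = Jacobian of the blow-up, `t^D |u|^M` = the explicit
powers of the pole and of the letters through `z₁` in the chart, `ω` = the regular factor,
two-sided bounded) and a measurable `Λ'` (the fibre mass in the chart) that is almost decreasing
towards the corner (`separateTwo_corner`), with logarithmic angular / radial costs where needed
(`separateTwo_cornerLog`, `separateTwo_radialLog`). The numerator is a double sum
`F(t, u) = ∑ κ im t^{i+m} u^{π im}` (part `HIAlgebra`), its pieces the partial sums over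
`im.1 = i`. If `|F| · wt` is integrable on `(0, 4δ) × (0, 4ε)` then every piece is
`wt`-integrable on `(0, δ) × (0, ε)`:
* `ray_pole_zero` (`s = 0`: the ray is the pole direction or the letter direction; the pieces
  are sums of monomials with non-zero matrix entries, `SepTwo.monomial_lt_top`);
* `ray_pole_order` (`s ≠ 0` at a point of the pole line; the pieces are `O(t^{a₀})` for the
  order `a₀`, `SepTwo.order_lt_top`), registered as `separateTwo_hiRay`;
* `ray_away` (`D = M = 0`, off the pole line: the weight itself is integrable,
  `SepTwo.mass_lt_top`; the pieces are bounded there).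
-/

noncomputable section

open Set MeasureTheory
open scoped ENNReal

namespace Summit.KontsevichZagierPeriods.ArrangementNormalForm.JanusBands

namespace SepTwo

/-! ### The weight -/

/-- The scalar part of the weight: `t / (t^D |s + σ v|^M ω(t, v))`. -/
def phi (D M : ℕ) (s σ : ℝ) (ω : ℝ → ℝ → ℝ) (t v : ℝ) : ℝ :=
  t / (t ^ D * |s + σ * v| ^ M * ω t v)

/-- The weight `ofReal (phi) · Λ'`. -/
def wt (D M : ℕ) (s σ : ℝ) (ω : ℝ → ℝ → ℝ) (Λ' : ℝ → ℝ → ℝ≥0∞) (t v : ℝ) : ℝ≥0∞ :=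
  ENNReal.ofReal (phi D M s σ ω t v) * Λ' t v

/-- The weight is measurable. -/
theorem measurable_wt (D M : ℕ) (s σ : ℝ) {ω : ℝ → ℝ → ℝ} (hω : Measurable (Function.uncurry ω))
    {Λ' : ℝ → ℝ → ℝ≥0∞} (hΛ : Measurable (Function.uncurry Λ')) :
    Measurable (Function.uncurry (wt D M s σ ω Λ')) := by
  have h1 : Measurable fun p : ℝ × ℝ => phi D M s σ ω p.1 p.2 := by
    unfold phi
    refine measurable_fst.div ((((measurable_fst.pow_const D)).mul ?_).mul hω)
    exact ((measurable_const.add (measurable_snd.const_mul σ)).abs).pow_const M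
  exact (ENNReal.measurable_ofReal.comp h1).mul hΛ

/-- The ratio inequality for the scalar weight. -/
theorem phi_le {D M : ℕ} {s σ : ℝ} {ω : ℝ → ℝ → ℝ} {t v t' v' K : ℝ} (ht : 0 < t) (htt' : t ≤ t')
    (hden : 0 < t ^ D * |s + σ * v| ^ M * ω t v)
    (hden' : 0 < t' ^ D * |s + σ * v'| ^ M * ω t' v')
    (hK : t' ^ D * |s + σ * v'| ^ M * ω t' v' ≤ K * (t ^ D * |s + σ * v| ^ M * ω t v)) :
    phi D M s σ ω t v ≤ K * phi D M s σ ω t' v' := by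
  unfold phi
  have hK0 : 0 ≤ K := by
    by_contra h
    push Not at h
    nlinarith
  calc t / (t ^ D * |s + σ * v| ^ M * ω t v) ≤ t' / (t ^ D * |s + σ * v| ^ M * ω t v) :=
        div_le_div_of_nonneg_right htt' hden.le
    _ = t' * (1 / (t ^ D * |s + σ * v| ^ M * ω t v)) := by rw [mul_one_div]
    _ ≤ t' * (K / (t' ^ D * |s + σ * v'| ^ M * ω t' v')) := by
        refine mul_le_mul_of_nonneg_left ?_ (ht.le.trans htt')
        rw [div_le_div_iff₀ hden hden', one_mul]
        exact hK
    _ = K * (t' / (t' ^ D * |s + σ * v'| ^ M * ω t' v')) := by ring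

/-- The scalar weight is non-negative for `t ≥ 0` and `ω ≥ 0`. -/
theorem phi_nonneg {D M : ℕ} {s σ : ℝ} {ω : ℝ → ℝ → ℝ} {t v : ℝ} (ht : 0 ≤ t) (hω : 0 ≤ ω t v) :
    0 ≤ phi D M s σ ω t v := by
  unfold phi; positivity

/-- Transversal coordinates on a thin sector: `|u| > 0` and `|u'| ≤ 4 |u|`, `|u'| ≤ 3 |u|`. -/
theorem u_bounds {s σ ε v v' : ℝ} (hσ : |σ| = 1) (hs : s = 0 ∨ 4 * ε ≤ |s| / 2) (hv : 0 < v)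
    (hvv' : v ≤ v') (hv'v : v' ≤ 4 * v) (hv' : v' < 4 * ε) :
    0 < |s + σ * v| ∧ |s + σ * v'| ≤ 4 * |s + σ * v| ∧ (s ≠ 0 → |s + σ * v'| ≤ 3 * |s + σ * v|) := by
  rcases hs with rfl | hs
  · rw [zero_add, zero_add, abs_mul, abs_mul, hσ, one_mul, one_mul, abs_of_pos hv,
      abs_of_pos (hv.trans_le hvv')]
    exact ⟨hv, hv'v, fun h => absurd rfl h⟩
  · have h1 : |σ * v| = v := by rw [abs_mul, hσ, one_mul, abs_of_pos hv]
    have h2 : |σ * v'| = v' := by rw [abs_mul, hσ, one_mul, abs_of_pos (hv.trans_le hvv')]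
    have hlo : |s| / 2 ≤ |s + σ * v| := by
      have := abs_sub_abs_le_abs_sub s (-(σ * v))
      rw [abs_neg, h1, sub_neg_eq_add] at this
      linarith
    have hhi : |s + σ * v'| ≤ 3 * (|s| / 2) := by
      have := abs_add_le s (σ * v')
      rw [h2] at this
      linarith
    have hs0 : 0 < |s| := by linarith
    exact ⟨by linarith, by linarith, fun _ => by linarith⟩

/-- **The weight is almost decreasing towards the corner.** -/
theorem wt_mono (D M : ℕ) {s σ : ℝ} (hσ : |σ| = 1) {ω : ℝ → ℝ → ℝ} {Λ' : ℝ → ℝ → ℝ≥0∞}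
    {δ ε : ℝ} (hs : M = 0 ∨ s = 0 ∨ 4 * ε ≤ |s| / 2) {ωlo ωhi : ℝ} (hωlo : 0 < ωlo)
    (hω : ∀ t ∈ Ioo (0 : ℝ) (4 * δ), ∀ v ∈ Ioo (0 : ℝ) (4 * ε), ωlo ≤ ω t v ∧ ω t v ≤ ωhi)
    (KΛ : ℝ≥0∞)
    (hΛ : ∀ x v x' v', 0 < x → x ≤ x' → x' ≤ 4 * x → x' < 4 * δ → 0 < v → v ≤ v' →
      v' ≤ 4 * v → v' < 4 * ε → Λ' x v ≤ KΛ * Λ' x' v') :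
    ∀ x v x' v', 0 < x → x ≤ x' → x' ≤ 4 * x → x' < 4 * δ → 0 < v → v ≤ v' →
      v' ≤ 4 * v → v' < 4 * ε → wt D M s σ ω Λ' x v ≤
        (ENNReal.ofReal (4 ^ D * 4 ^ M * (ωhi / ωlo)) * KΛ) * wt D M s σ ω Λ' x' v' := by
  intro x v x' v' hx hxx' hx'x hx' hv hvv' hv'v hv'
  have hxr : x ∈ Ioo (0 : ℝ) (4 * δ) := ⟨hx, by linarith⟩
  have hx'r : x' ∈ Ioo (0 : ℝ) (4 * δ) := ⟨by linarith, hx'⟩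
  have hvr : v ∈ Ioo (0 : ℝ) (4 * ε) := ⟨hv, by linarith⟩
  have hv'r : v' ∈ Ioo (0 : ℝ) (4 * ε) := ⟨by linarith, hv'⟩
  obtain ⟨hω1, hω2⟩ := hω x hxr v hvr
  obtain ⟨hω1', hω2'⟩ := hω x' hx'r v' hv'r
  have hωpos : 0 < ω x v := hωlo.trans_le hω1
  have hωpos' : 0 < ω x' v' := hωlo.trans_le hω1'
  have hωhi : 0 < ωhi := hωpos.trans_le hω2
  -- the power of `|u|`
  have hu : 0 < |s + σ * v| ^ M ∧ 0 < |s + σ * v'| ^ M ∧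
      |s + σ * v'| ^ M ≤ 4 ^ M * |s + σ * v| ^ M := by
    rcases hs with hM | hs
    · subst hM; simp
    · obtain ⟨h0, h4, -⟩ := u_bounds hσ hs hv hvv' hv'v hv'
      refine ⟨pow_pos h0 M, pow_pos (by
        rcases hs with rfl | hs
        · rw [zero_add, abs_mul, hσ, one_mul]; exact abs_pos.2 (by linarith)
        · have := abs_sub_abs_le_abs_sub s (-(σ * v'))
          rw [abs_neg, abs_mul, hσ, one_mul, abs_of_pos (hv.trans_le hvv'), sub_neg_eq_add] at this
          exact lt_of_lt_of_le (by linarith) this) M, ?_⟩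
      rw [← mul_pow]
      exact pow_le_pow_left₀ (abs_nonneg _) h4 M
  obtain ⟨huM, huM', hu4⟩ := hu
  have hden : 0 < x ^ D * |s + σ * v| ^ M * ω x v := mul_pos (mul_pos (pow_pos hx D) huM) hωpos
  have hden' : 0 < x' ^ D * |s + σ * v'| ^ M * ω x' v' :=
    mul_pos (mul_pos (pow_pos (hx.trans_le hxx') D) huM') hωpos'
  have hK : x' ^ D * |s + σ * v'| ^ M * ω x' v' ≤
      (4 ^ D * 4 ^ M * (ωhi / ωlo)) * (x ^ D * |s + σ * v| ^ M * ω x v) := by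
    have h1 : x' ^ D ≤ 4 ^ D * x ^ D := by
      rw [← mul_pow]; exact pow_le_pow_left₀ (by linarith) hx'x D
    have h2 : ω x' v' ≤ (ωhi / ωlo) * ω x v := by
      rw [div_mul_eq_mul_div, le_div_iff₀ hωlo]
      exact (mul_le_mul hω2' hω1 hωlo.le (hωpos'.le.trans hω2'))
    calc x' ^ D * |s + σ * v'| ^ M * ω x' v'
        ≤ (4 ^ D * x ^ D) * (4 ^ M * |s + σ * v| ^ M) * ((ωhi / ωlo) * ω x v) :=
          mul_le_mul (mul_le_mul h1 hu4 huM'.le (by positivity)) h2 hωpos'.le (by positivity)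
      _ = _ := by ring
  have hφ := phi_le hx hxx' hden hden' hK
  unfold wt
  calc ENNReal.ofReal (phi D M s σ ω x v) * Λ' x v
      ≤ ENNReal.ofReal ((4 ^ D * 4 ^ M * (ωhi / ωlo)) * phi D M s σ ω x' v') * (KΛ * Λ' x' v') :=
        mul_le_mul (ENNReal.ofReal_le_ofReal hφ) (hΛ x v x' v' hx hxx' hx'x hx' hv hvv' hv'v hv')
          zero_le zero_le
    _ = _ := by
        rw [ENNReal.ofReal_mul (by positivity)]; ring

/-- **The weight has a logarithmic angular cost** (off the direction `s = 0`, or without the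
`|u|`-power). -/
theorem wt_ang (D M : ℕ) {s σ : ℝ} (hσ : |σ| = 1) {ω : ℝ → ℝ → ℝ} {Λ' : ℝ → ℝ → ℝ≥0∞}
    {δ ε : ℝ} (hs : M = 0 ∨ (s ≠ 0 ∧ 4 * ε ≤ |s| / 2)) {ωlo ωhi : ℝ} (hωlo : 0 < ωlo)
    (hω : ∀ t ∈ Ioo (0 : ℝ) (4 * δ), ∀ v ∈ Ioo (0 : ℝ) (4 * ε), ωlo ≤ ω t v ∧ ω t v ≤ ωhi)
    (Kn : ℕ) (CΛ : ℝ≥0∞)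
    (hΛ : ∀ x, 0 < x → x < δ → ∀ v v', 0 < v → v ≤ v' → v' < ε →
      Λ' x v ≤ CΛ * ENNReal.ofReal ((1 + Real.log (v' / v)) ^ Kn) * Λ' x v') :
    ∀ x, 0 < x → x < δ → ∀ v v', 0 < v → v ≤ v' → v' < ε →
      wt D M s σ ω Λ' x v ≤ (ENNReal.ofReal (3 ^ M * (ωhi / ωlo)) * CΛ) *
        ENNReal.ofReal ((1 + Real.log (v' / v)) ^ Kn) * wt D M s σ ω Λ' x v' := by
  intro x hx hxδ v v' hv hvv' hv'
  have hδ : 0 < δ := hx.trans hxδ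
  have hε : 0 < ε := hv.trans (hvv'.trans_lt hv')
  have hxr : x ∈ Ioo (0 : ℝ) (4 * δ) := ⟨hx, by linarith⟩
  have hvr : v ∈ Ioo (0 : ℝ) (4 * ε) := ⟨hv, by linarith⟩
  have hv'r : v' ∈ Ioo (0 : ℝ) (4 * ε) := ⟨by linarith, by linarith⟩
  obtain ⟨hω1, hω2⟩ := hω x hxr v hvr
  obtain ⟨hω1', hω2'⟩ := hω x hxr v' hv'r
  have hωpos : 0 < ω x v := hωlo.trans_le hω1
  have hωpos' : 0 < ω x v' := hωlo.trans_le hω1'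
  have hωhi : 0 < ωhi := hωpos.trans_le hω2
  have hu : 0 < |s + σ * v| ^ M ∧ 0 < |s + σ * v'| ^ M ∧
      |s + σ * v'| ^ M ≤ 3 ^ M * |s + σ * v| ^ M := by
    rcases hs with hM | ⟨hs0, hs⟩
    · subst hM; simp
    · have h1 : |σ * v| = v := by rw [abs_mul, hσ, one_mul, abs_of_pos hv]
      have h2 : |σ * v'| = v' := by rw [abs_mul, hσ, one_mul, abs_of_pos (hv.trans_le hvv')]
      have hs' : 0 < |s| := abs_pos.2 hs0
      have hlo : |s| / 2 ≤ |s + σ * v| := by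
        have := abs_sub_abs_le_abs_sub s (-(σ * v))
        rw [abs_neg, h1, sub_neg_eq_add] at this; linarith
      have hlo' : |s| / 2 ≤ |s + σ * v'| := by
        have := abs_sub_abs_le_abs_sub s (-(σ * v'))
        rw [abs_neg, h2, sub_neg_eq_add] at this; linarith
      have hhi : |s + σ * v'| ≤ 3 * |s + σ * v| := by
        have := abs_add_le s (σ * v'); rw [h2] at this; linarith
      refine ⟨pow_pos (by linarith) M, pow_pos (by linarith) M, ?_⟩
      rw [← mul_pow]; exact pow_le_pow_left₀ (abs_nonneg _) hhi M
  obtain ⟨huM, huM', hu3⟩ := hu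
  have hden : 0 < x ^ D * |s + σ * v| ^ M * ω x v := mul_pos (mul_pos (pow_pos hx D) huM) hωpos
  have hden' : 0 < x ^ D * |s + σ * v'| ^ M * ω x v' :=
    mul_pos (mul_pos (pow_pos hx D) huM') hωpos'
  have hK : x ^ D * |s + σ * v'| ^ M * ω x v' ≤
      (3 ^ M * (ωhi / ωlo)) * (x ^ D * |s + σ * v| ^ M * ω x v) := by
    have h2 : ω x v' ≤ (ωhi / ωlo) * ω x v := by
      rw [div_mul_eq_mul_div, le_div_iff₀ hωlo]
      exact (mul_le_mul hω2' hω1 hωlo.le (hωpos'.le.trans hω2'))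
    calc x ^ D * |s + σ * v'| ^ M * ω x v'
        ≤ x ^ D * (3 ^ M * |s + σ * v| ^ M) * ((ωhi / ωlo) * ω x v) :=
          mul_le_mul (mul_le_mul_of_nonneg_left hu3 (by positivity)) h2 hωpos'.le (by positivity)
      _ = _ := by ring
  have hφ := phi_le hx le_rfl hden hden' hK
  unfold wt
  calc ENNReal.ofReal (phi D M s σ ω x v) * Λ' x v
      ≤ ENNReal.ofReal ((3 ^ M * (ωhi / ωlo)) * phi D M s σ ω x v') *
          (CΛ * ENNReal.ofReal ((1 + Real.log (v' / v)) ^ Kn) * Λ' x v') :=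
        mul_le_mul (ENNReal.ofReal_le_ofReal hφ) (hΛ x hx hxδ v v' hv hvv' hv') zero_le
          zero_le
    _ = _ := by
        rw [ENNReal.ofReal_mul (by positivity)]; ring

/-- **The weight has a logarithmic radial cost** (without explicit powers). -/
theorem wt_rad {s σ : ℝ} {ω : ℝ → ℝ → ℝ} {Λ' : ℝ → ℝ → ℝ≥0∞} {δ ε : ℝ} {ωlo ωhi : ℝ}
    (hωlo : 0 < ωlo)
    (hω : ∀ t ∈ Ioo (0 : ℝ) (4 * δ), ∀ v ∈ Ioo (0 : ℝ) (4 * ε), ωlo ≤ ω t v ∧ ω t v ≤ ωhi)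
    (Kn : ℕ) (CΛ : ℝ≥0∞)
    (hΛ : ∀ v, 0 < v → v < ε → ∀ x x', 0 < x → x ≤ x' → x' < δ →
      Λ' x v ≤ CΛ * ENNReal.ofReal ((1 + Real.log (x' / x)) ^ Kn) * Λ' x' v) :
    ∀ v, 0 < v → v < ε → ∀ x x', 0 < x → x ≤ x' → x' < δ →
      wt 0 0 s σ ω Λ' x v ≤ (ENNReal.ofReal (ωhi / ωlo) * CΛ) *
        ENNReal.ofReal ((1 + Real.log (x' / x)) ^ Kn) * wt 0 0 s σ ω Λ' x' v := by
  intro v hv hvε x x' hx hxx' hx'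
  have hε : 0 < ε := hv.trans hvε
  have hxr : x ∈ Ioo (0 : ℝ) (4 * δ) := ⟨hx, by linarith⟩
  have hx'r : x' ∈ Ioo (0 : ℝ) (4 * δ) := ⟨by linarith, by linarith⟩
  have hvr : v ∈ Ioo (0 : ℝ) (4 * ε) := ⟨hv, by linarith⟩
  obtain ⟨hω1, hω2⟩ := hω x hxr v hvr
  obtain ⟨hω1', hω2'⟩ := hω x' hx'r v hvr
  have hωpos : 0 < ω x v := hωlo.trans_le hω1
  have hωpos' : 0 < ω x' v := hωlo.trans_le hω1'
  have hωhi : 0 < ωhi := hωpos.trans_le hω2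
  have hden : 0 < x ^ 0 * |s + σ * v| ^ 0 * ω x v := by simpa using hωpos
  have hden' : 0 < x' ^ 0 * |s + σ * v| ^ 0 * ω x' v := by simpa using hωpos'
  have hK : x' ^ 0 * |s + σ * v| ^ 0 * ω x' v ≤ (ωhi / ωlo) * (x ^ 0 * |s + σ * v| ^ 0 * ω x v) := by
    simp only [pow_zero, one_mul]
    rw [div_mul_eq_mul_div, le_div_iff₀ hωlo]
    exact (mul_le_mul hω2' hω1 hωlo.le (hωpos'.le.trans hω2'))
  have hφ := phi_le hx hxx' hden hden' hK
  unfold wt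
  calc ENNReal.ofReal (phi 0 0 s σ ω x v) * Λ' x v
      ≤ ENNReal.ofReal ((ωhi / ωlo) * phi 0 0 s σ ω x' v) *
          (CΛ * ENNReal.ofReal ((1 + Real.log (x' / x)) ^ Kn) * Λ' x' v) :=
        mul_le_mul (ENNReal.ofReal_le_ofReal hφ) (hΛ v hv hvε x x' hx hxx' hx') zero_le
          zero_le
    _ = _ := by
        rw [ENNReal.ofReal_mul (by positivity)]; ring

end SepTwo

/-- **The weight of a thin sector is almost decreasing towards the corner** (registered part of
`stub_separateTwoPos_hI`; literal form of `SepTwo.wt_mono`): the weight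
`ofReal (x / (x^D |s + σ v|^M ω(x, v))) · Λ'(x, v)` with a two-sided bounded regular factor `ω`
and an almost-decreasing `Λ'` is almost decreasing at scale `4`, with constant
`4^D 4^M (ωhi/ωlo) · KΛ`. -/
theorem separateTwo_hiRayWeight (D M : ℕ) (s σ : ℝ) (hσ : |σ| = 1) (ω : ℝ → ℝ → ℝ) (Λ' : ℝ → ℝ → ENNReal) (δ ε : ℝ) (hs : M = 0 ∨ s = 0 ∨ 4 * ε ≤ |s| / 2) (ωlo ωhi : ℝ) (hωlo : 0 < ωlo) (hω : ∀ t ∈ Set.Ioo (0 : ℝ) (4 * δ), ∀ v ∈ Set.Ioo (0 : ℝ) (4 * ε), ωlo ≤ ω t v ∧ ω t v ≤ ωhi) (KΛ : ENNReal) (hΛ : ∀ x v x' v' : ℝ, 0 < x → x ≤ x' → x' ≤ 4 * x → x' < 4 * δ → 0 < v → v ≤ v' → v' ≤ 4 * v → v' < 4 * ε → Λ' x v ≤ KΛ * Λ' x' v') (x v x' v' : ℝ) (hx : 0 < x) (hxx' : x ≤ x') (hx'x : x' ≤ 4 * x) (hx' : x' < 4 * δ) (hv : 0 < v) (hvv'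 : v ≤ v') (hv'v : v' ≤ 4 * v) (hv' : v' < 4 * ε) : ENNReal.ofReal (x / (x ^ D * |s + σ * v| ^ M * ω x v)) * Λ' x v ≤ (ENNReal.ofReal (4 ^ D * 4 ^ M * (ωhi / ωlo)) * KΛ) * (ENNReal.ofReal (x' / (x' ^ D * |s + σ * v'| ^ M * ω x' v')) * Λ' x' v') := by
  exact SepTwo.wt_mono D M hσ hs hωlo hω KΛ hΛ x v x' v' hx hxx' hx'x hx' hv hvv' hv'v hv'

end Summit.KontsevichZagierPeriods.ArrangementNormalForm.JanusBands
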